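import Mathlib.Analysis.Normed.Module.Convex
import Mathlib.Analysis.LocallyConvex.WithSeminorms
import Mathlib.Topology.Algebra.Module.LocallyConvex
import Mathlib.Topology.Connected.LocallyPathConnected
import Mathlib.Topology.MetricSpace.Thickening
import Mathlib.Topology.MetricSpace.ProperSpace
import Mathlib.Combinatorics.SimpleGraph.Connectivity.Connected
import HarnessLib

/-!
# Harnack chains: compact connected envelopes and uniform chains of small steps

Analysis/FluidPDE support file (all results proved, folklore point-set topology) for the proof of
KNSS 2009, Lemma 2.1 (`Literature.Analysis.FluidPDE.KNSS2009_lemma21`) from the interior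
parabolic Harnack inequality (`Literature.Analysis.FluidPDE.Lieberman1996_harnack_drift`). The
classical "Harnack chain" argument (Moser 1961/1964; Lieberman 1996, Ch. II, proof of Theorem 2.7
and Ch. VI, Theorem 6.25: "the chaining argument") propagates a pointwise Harnack inequality on
small cylinders along finite chains of overlapping balls inside a connected domain; what it needs
from topology is

* `exists_isCompact_isConnected_superset`: a compact subset `S` of an open connected set `Ω` in a
  real normed space with compact closed balls lies in a compact *connected* `S' ⊆ Ω` (join
  finitely many small balls covering `S` to a base point by paths in `Ω`, which is path
  connected, being open and connected in a locally path-connected space);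
* `exists_uniform_chain`: in a compact preconnected set `S`, any two points are joined, for
  every step size `R > 0`, by a chain of points of `S` with consecutive distances `< R` and
  **length bounded by a number `N = N(S, R)` independent of the two points** (cover `S` by
  finitely many balls of radius `R/2` centred in `S`; the graph "the two balls meet" on the
  centres is connected because `S` is preconnected, and a path in a finite graph is shorter
  than the number of vertices).

## Mathlib

Uses `IsOpen.isConnected_iff_isPathConnected` (locally path-connected spaces; real normed spaces
are, through `LocallyConvexSpace.toLocallyPathConnectedSpace`), `finite_cover_balls_of_compact`,
`IsCompact.exists_cthickening_subset_open`, `IsPreconnected.subset_or_subset`, and the finite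
graph API `SimpleGraph.Walk.bypass`, `SimpleGraph.Walk.IsPath.length_lt`.
-/

noncomputable section

open Set Metric Function

namespace Literature.Analysis.FluidPDE

section Envelope

variable {E : Type*} [NormedAddCommGroup E] [NormedSpace ℝ E] [ProperSpace E]

/-- **Compact connected envelope.** If `Ω` is open and connected in a real normed space with
compact closed balls and `S ⊆ Ω` is compact and nonempty, there is a compact connected `S'` with
`S ⊆ S' ⊆ Ω` (finitely many closed balls covering `S`, joined to a base point by paths in the
path-connected set `Ω`). This is the set along which Harnack chains are run (Lieberman 1996,
Ch. VI, Thm 6.25, "the chaining argument"). [folklore] -/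
theorem exists_isCompact_isConnected_superset {Ω S : Set E} (hΩ : IsOpen Ω)
    (hΩc : IsConnected Ω) (hS : IsCompact S) (hSΩ : S ⊆ Ω) (hne : S.Nonempty) :
    ∃ S' : Set E, IsCompact S' ∧ IsConnected S' ∧ S ⊆ S' ∧ S' ⊆ Ω := by
  classical
  obtain ⟨p₀, hp₀⟩ := hne
  have hpc : IsPathConnected Ω := hΩ.isConnected_iff_isPathConnected.1 hΩc
  -- a margin `m` and a finite cover of `S` by balls of radius `m / 2` centred in `S`
  obtain ⟨m, hm, hmΩ⟩ := hS.exists_cthickening_subset_open hΩ hSΩ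
  obtain ⟨t, htS, htfin, hcov⟩ := finite_cover_balls_of_compact hS (half_pos hm)
  -- paths from the base point to the centres
  have hj : ∀ q ∈ t, JoinedIn Ω p₀ q := fun q hq => hpc.joinedIn p₀ (hSΩ hp₀) q (hSΩ (htS hq))
  choose γ hγ using hj
  -- the traces of the paths (empty off `t`, to have a non-dependent union)
  set P : E → Set E := fun q => if hq : q ∈ t then range (γ q hq) else ∅ with hP
  have hPq : ∀ q (hq : q ∈ t), P q = range (γ q hq) := fun q hq => by simp only [hP, dif_pos hq]
  -- the envelope
  refine ⟨⋃ q ∈ t, (closedBall q (m / 2) ∪ P q), ?_, ?_, ?_, ?_⟩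
  · -- compact: a finite union of compact sets
    refine htfin.isCompact_biUnion fun q hq => ?_
    rw [hPq q hq]
    exact (isCompact_closedBall q (m / 2)).union (isCompact_range (γ q hq).continuous)
  · -- connected: every piece is connected and contains `p₀`
    have hpiece : ∀ q ∈ t, IsConnected (closedBall q (m / 2) ∪ P q) := by
      intro q hq
      rw [hPq q hq]
      have h1 : IsConnected (closedBall q (m / 2)) :=
        (convex_closedBall q (m / 2)).isConnected ⟨q, mem_closedBall_self (half_pos hm).le⟩
      have h2 : IsConnected (range (γ q hq)) := isConnected_range (γ q hq).continuous
      exact IsConnected.union ⟨q, mem_closedBall_self (half_pos hm).le, ⟨1, (γ q hq).target⟩⟩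
        h1 h2
    have hmem : ∀ q ∈ t, p₀ ∈ closedBall q (m / 2) ∪ P q := fun q hq => by
      rw [hPq q hq]; exact Or.inr ⟨0, (γ q hq).source⟩
    -- the cover is nonempty since `p₀ ∈ S`
    obtain ⟨q₀, hq₀, -⟩ : ∃ q ∈ t, p₀ ∈ ball q (m / 2) := by
      simpa only [mem_iUnion, exists_prop] using hcov hp₀
    refine ⟨⟨p₀, mem_iUnion₂.2 ⟨q₀, hq₀, hmem q₀ hq₀⟩⟩, ?_⟩
    rw [biUnion_eq_iUnion]
    exact isPreconnected_iUnion ⟨p₀, mem_iInter.2 fun q => hmem q.1 q.2⟩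
      fun q => (hpiece q.1 q.2).isPreconnected
  · -- contains `S`
    intro x hx
    obtain ⟨q, hq, hxq⟩ : ∃ q ∈ t, x ∈ ball q (m / 2) := by
      simpa only [mem_iUnion, exists_prop] using hcov hx
    exact mem_iUnion₂.2 ⟨q, hq, Or.inl (ball_subset_closedBall hxq)⟩
  · -- inside `Ω`
    refine iUnion₂_subset fun q hq => union_subset ?_ ?_
    · refine ((closedBall_subset_closedBall (by linarith)).trans
        (closedBall_subset_cthickening (htS hq) m)).trans hmΩ
    · rw [hPq q hq]
      rintro _ ⟨s, rfl⟩
      exact hγ q hq s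

end Envelope

section Chain

variable {E : Type*} [PseudoMetricSpace E]

/-- **Uniform chains in a compact preconnected set.** If `S` is compact and preconnected and
`R > 0`, there is `N` such that any two points `p, q ∈ S` are joined by a chain
`p = z₀, z₁, …, z_L = q` of points of `S` with `dist zᵢ zᵢ₊₁ < R` and `L ≤ N` (cover `S` by
finitely many balls `B(c, R/2)` with `c ∈ S`; the graph on the centres in which `c ∼ c'` iff
`B(c, R/2) ∩ B(c', R/2) ≠ ∅` is connected, since otherwise the balls of one component and those
of the others would disconnect `S`; and a simple path in a finite graph has fewer edges than the
graph has vertices). This is the combinatorial half of the Harnack chain argument (Lieberman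
1996, Ch. VI, Thm 6.25). [folklore] -/
theorem exists_uniform_chain {S : Set E} (hS : IsCompact S) (hSc : IsPreconnected S) {R : ℝ}
    (hR : 0 < R) :
    ∃ N : ℕ, ∀ p ∈ S, ∀ q ∈ S, ∃ L : ℕ, L ≤ N ∧ ∃ z : ℕ → E,
      z 0 = p ∧ z L = q ∧ (∀ i ≤ L, z i ∈ S) ∧ ∀ i < L, dist (z i) (z (i + 1)) < R := by
  classical
  obtain ⟨t, htS, htfin, hcov⟩ := finite_cover_balls_of_compact hS (half_pos hR)
  set tf : Finset E := htfin.toFinset with htf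
  have hmem_tf : ∀ {c : E}, c ∈ tf ↔ c ∈ t := fun {c} => by rw [htf, Finite.mem_toFinset]
  have hcov' : ∀ x ∈ S, ∃ c ∈ tf, x ∈ ball c (R / 2) := by
    intro x hx
    obtain ⟨c, hc, hxc⟩ : ∃ c ∈ t, x ∈ ball c (R / 2) := by
      simpa only [mem_iUnion, exists_prop] using hcov hx
    exact ⟨c, hmem_tf.2 hc, hxc⟩
  -- the intersection graph on the centres
  set V := {c : E // c ∈ tf} with hV
  set G : SimpleGraph V := SimpleGraph.fromRel fun a b : V =>
    (ball (a : E) (R / 2) ∩ ball (b : E) (R / 2)).Nonempty with hG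
  have hGadj : ∀ {a b : V}, G.Adj a b ↔ a ≠ b ∧
      (ball (a : E) (R / 2) ∩ ball (b : E) (R / 2)).Nonempty := by
    intro a b
    rw [hG, SimpleGraph.fromRel_adj]
    constructor
    · rintro ⟨hne, h | h⟩
      · exact ⟨hne, h⟩
      · exact ⟨hne, by rwa [inter_comm]⟩
    · rintro ⟨hne, h⟩
      exact ⟨hne, Or.inl h⟩
  have hdist_of_adj : ∀ {a b : V}, G.Adj a b → dist (a : E) b < R := by
    intro a b hab
    obtain ⟨-, z, hza, hzb⟩ := hGadj.1 hab
    rw [mem_ball] at hza hzb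
    calc dist (a : E) b ≤ dist (a : E) z + dist z b := dist_triangle _ _ _
      _ < R / 2 + R / 2 := by rw [dist_comm] at hza; exact add_lt_add hza hzb
      _ = R := by ring
  -- the graph is connected, because `S` is preconnected
  have hreach : ∀ a b : V, G.Reachable a b := by
    intro a b
    set U₁ : Set E := ⋃ (c : V) (_ : G.Reachable a c), ball (c : E) (R / 2) with hU₁
    set U₂ : Set E := ⋃ (c : V) (_ : ¬ G.Reachable a c), ball (c : E) (R / 2) with hU₂
    have hU₁o : IsOpen U₁ := isOpen_iUnion fun _ => isOpen_iUnion fun _ => isOpen_ball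
    have hU₂o : IsOpen U₂ := isOpen_iUnion fun _ => isOpen_iUnion fun _ => isOpen_ball
    have hdisj : Disjoint U₁ U₂ := by
      rw [disjoint_left]
      intro z hz₁ hz₂
      simp only [hU₁, hU₂, mem_iUnion, exists_prop] at hz₁ hz₂
      obtain ⟨c₁, hc₁, hzc₁⟩ := hz₁
      obtain ⟨c₂, hc₂, hzc₂⟩ := hz₂
      have hne : c₁ ≠ c₂ := by rintro rfl; exact hc₂ hc₁
      exact hc₂ (hc₁.trans (hGadj.2 ⟨hne, z, hzc₁, hzc₂⟩).reachable)
    have hScov : S ⊆ U₁ ∪ U₂ := by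
      intro x hx
      obtain ⟨c, hc, hxc⟩ := hcov' x hx
      by_cases h : G.Reachable a ⟨c, hc⟩
      · exact Or.inl (by simp only [hU₁, mem_iUnion, exists_prop]; exact ⟨⟨c, hc⟩, h, hxc⟩)
      · exact Or.inr (by simp only [hU₂, mem_iUnion, exists_prop]; exact ⟨⟨c, hc⟩, h, hxc⟩)
    have haU₁ : (a : E) ∈ U₁ := by
      simp only [hU₁, mem_iUnion, exists_prop]
      exact ⟨a, SimpleGraph.Reachable.refl _, mem_ball_self (half_pos hR)⟩
    have haS : (a : E) ∈ S := htS (hmem_tf.1 a.2)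
    rcases hSc.subset_or_subset hU₁o hU₂o hdisj hScov with h | h
    · have hbS : (b : E) ∈ S := htS (hmem_tf.1 b.2)
      have hb := h hbS
      simp only [hU₁, mem_iUnion, exists_prop] at hb
      obtain ⟨c, hc, hbc⟩ := hb
      by_cases hcb : c = b
      · exact hcb ▸ hc
      · exact hc.trans (hGadj.2 ⟨hcb, b, hbc, mem_ball_self (half_pos hR)⟩).reachable
    · exact absurd (h haS) (disjoint_left.1 hdisj haU₁)
  -- the bound: a simple path has fewer edges than there are centres
  refine ⟨tf.card + 1, fun p hp q hq => ?_⟩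
  obtain ⟨c, hc, hpc⟩ := hcov' p hp
  obtain ⟨d, hd, hqd⟩ := hcov' q hq
  obtain ⟨w⟩ := hreach ⟨c, hc⟩ ⟨d, hd⟩
  set w' := w.bypass with hw'
  have hpath : w'.IsPath := w.bypass_isPath
  have hlen : w'.length < tf.card := by
    have h := hpath.length_lt
    rwa [Fintype.card_coe] at h
  -- the chain `p, c = w'₀, w'₁, …, w'_ℓ = d, q`
  set z : ℕ → E := fun i => if i = 0 then p else if i ≤ w'.length + 1 then
    ((w'.getVert (i - 1) : V) : E) else q with hz
  refine ⟨w'.length + 2, by omega, z, by simp [hz], ?_, ?_, ?_⟩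
  · have h1 : w'.length + 2 ≠ 0 := by omega
    have h2 : ¬ (w'.length + 2 ≤ w'.length + 1) := by omega
    simp [hz, h2]
  · intro i _
    by_cases hi0 : i = 0
    · simp only [hz, hi0, if_true]; exact hp
    · by_cases hi1 : i ≤ w'.length + 1
      · simp only [hz, hi0, hi1, if_false, if_true]
        exact htS (hmem_tf.1 (w'.getVert (i - 1)).2)
      · simp only [hz, hi0, hi1, if_false]; exact hq
  · intro i hi
    by_cases hi0 : i = 0
    · -- from `p` to the first centre `c`
      subst hi0
      have h01 : (0 + 1 : ℕ) ≤ w'.length + 1 := by omega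
      simp only [hz, if_true, Nat.zero_add, one_ne_zero, if_false, h01, Nat.sub_self,
        SimpleGraph.Walk.getVert_zero]
      exact (mem_ball.1 hpc).trans (half_lt_self hR)
    · by_cases hil : i ≤ w'.length
      · -- along the path: adjacent centres
        have hi1 : i ≤ w'.length + 1 := by omega
        have hi2 : i + 1 ≤ w'.length + 1 := by omega
        have hi3 : i + 1 ≠ 0 := by omega
        simp only [hz, hi0, hi1, hi2, hi3, if_false, if_true, Nat.add_sub_cancel]
        have hadj := w'.adj_getVert_succ (i := i - 1) (by omega)
        rw [show i - 1 + 1 = i from by omega] at hadj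
        exact hdist_of_adj hadj
      · -- from the last centre `d` to `q`
        have hieq : i = w'.length + 1 := by omega
        have hi1 : i ≤ w'.length + 1 := by omega
        have hi2 : ¬ (i + 1 ≤ w'.length + 1) := by omega
        have hi3 : i + 1 ≠ 0 := by omega
        simp only [hz, hi0, hi1, hi2, hi3, if_false, if_true]
        rw [hieq, Nat.add_sub_cancel, SimpleGraph.Walk.getVert_length, dist_comm]
        exact (mem_ball.1 hqd).trans (half_lt_self hR)

end Chain

end Literature.Analysis.FluidPDE

end
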